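import Summits.CriticalPhenomena.SAWScalingLimit.Theorems.SAWDevelopingMapObservableToSLEChordalCarrierLimits
import Summits.CriticalPhenomena.SAWScalingLimit.Theorems.SAWDevelopingMapHexConjectureRangeIdentificationHyperspace

/-!
# Crux `HexConjecture` (stmt-CriticalPhenomena-0808), line `root-locality-replaces-loewner`,
stub `stub_rangeIdentification`: subsequential limits of the RANGE laws of the critical hexagonal
SAW and what they inherit from the avoidance cocycle (part 1b)

Landing target:
`Summits/CriticalPhenomena/SAWScalingLimit/Theorems/SAWDevelopingMapHexConjectureRangeIdentificationLattice.lean`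
(`--supports stmt-CriticalPhenomena-0808`).

Setting: a Dobrushin domain `(D; a, b)`, an endpoint approximation `a δ, b δ`
(`IsEmbEndpointApprox`), the critical hexagonal SAW law `hexSAWLaw D.carrier δ (a δ) (b δ)` and
the RANGE `K_δ = range γ_δ ∈ NonemptyCompacts ℂ` of its polyline.  PROVED here:

* lattice facts: `K_δ ⊆ closure D` as soon as `a δ ≠ b δ` (`range_curve_subset_closure`), `K_δ`
  is connected and contains `δ a_δ`, `δ b_δ`; so the laws of `K_δ` are eventually probability
  measures carried by the compact subset `{K | K ⊆ closure D}` of the hyperspace;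
* **`exists_subseqLimit` — extraction and inheritance.**  For EVERY sequence of meshes
  `s n → 0⁺` there are a shift `N₀`, a subsequence `φ` and a probability measure `ν` on
  `NonemptyCompacts ℂ` such that the laws of `K_{s (φ n + N₀)}` converge weakly to `ν`
  (relative compactness for free: part 1a, Prokhorov on the compact piece `{K ⊆ closure D}` —
  NO tightness estimate), and `ν` inherits, by the two halves of the portmanteau theorem:
  (H1) `μ {range ⊆ cl D'} ≤ ν {K ⊆ cl D'}` for every hull subdomain `D'`, whenever the
  probabilities of the CLOSED events `{range γ_δ ⊆ cl D'}` converge to `μ {range ⊆ cl D'}` (the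
  conclusion of the avoidance cocycle `HexAvoidanceCocycle` for `D`); (H2)
  `ν {K ∩ S = ∅} ≤ μ {range ⊆ cl D'}` for every closed `S` with `cl D ∖ S ⊆ cl D'` (OPEN event,
  and `K_δ ∩ S = ∅` forces `K_δ ⊆ cl D'`); (H3) `ν`-a.s. `K ⊆ cl D`, `K` is connected and
  contains both marked points.

These are exactly the hypotheses under which the sequel files identify `ν` with the law of the
range of the chordal SLE(8/3) curve ([LSW] Lemma 3.2 for random compact sets from `a` to `b`).
References: P. Billingsley, *Convergence of probability measures* (1999), Thm. 2.1, Thm. 5.1;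
G. F. Lawler, O. Schramm, W. Werner, J. Amer. Math. Soc. 16 (2003), Lemma 3.2.
-/

noncomputable section

namespace Summit.CriticalPhenomena.SAWScalingLimit.Theorems.HexConjecture.RootLocality.Range

open scoped Topology NNReal ENNReal BoundedContinuousFunction
open Filter Set MeasureTheory TopologicalSpace Metric
open Literature.Probability.LatticeModels (HexVertex hexGraph hexCenter)
open Literature.Probability.RandomPlanarGeometry
open Literature.Probability.RandomPlanarGeometry.SAW
open Summit.CriticalPhenomena.SAWScalingLimit.Theorems.ObservableToSLE.Negative
  (eventually_isProbabilityMeasure_hexSAWLaw source_hexCurve target_hexCurve)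
open Summit.CriticalPhenomena.SAWScalingLimit.Theorems.ObservableToSLE.FloorRatio
  (range_curve_subset_closure eventually_ne_of_tendsto)

/-! ### The range of the polyline of a SAW as a point of the hyperspace -/

section Lattice

variable {Ω : Set ℂ} {δ : ℝ} {u v : HexVertex}

/-- The range of the polyline of a SAW is preconnected (a continuous image of `[0, 1]`).
[folklore] -/
theorem isPreconnected_range_curve (γ : HexDomainSAW Ω δ u v) : IsPreconnected γ.curve.range := by
  change IsPreconnected (Curve.range _)
  exact isPreconnected_range (Curve.continuous _)

/-- The rescaled starting vertex lies on the range. [folklore] -/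
theorem start_mem_range_curve (γ : HexDomainSAW Ω δ u v) :
    (δ : ℂ) * hexCenter u ∈ γ.curve.range := by
  rw [← source_hexCurve δ γ]
  exact γ.curve.source_mem_range

/-- The rescaled final vertex lies on the range. [folklore] -/
theorem end_mem_range_curve (γ : HexDomainSAW Ω δ u v) :
    (δ : ℂ) * hexCenter v ∈ γ.curve.range := by
  rw [← target_hexCurve δ γ]
  exact γ.curve.target_mem_range

end Lattice

/-! ### The laws of the ranges and their closed / open events -/

section Laws

variable [MeasurableSpace (NonemptyCompacts ℂ)] [BorelSpace (NonemptyCompacts ℂ)]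
  {Ω : Set ℂ} {δ : ℝ} {u v : HexVertex}

omit [BorelSpace (NonemptyCompacts ℂ)] in
/-- The range map `γ ↦ range γ.curve ∈ NonemptyCompacts ℂ` on the (discrete) space of SAWs is
measurable. [folklore] -/
theorem measurable_rangeOfSAW :
    Measurable (fun γ : HexDomainSAW Ω δ u v =>
      (⟨⟨γ.curve.range, γ.curve.isCompact_range⟩, γ.curve.range_nonempty⟩ : NonemptyCompacts ℂ)) :=
  fun _ _ => MeasurableSpace.measurableSet_top

/-- **The law of the range on a hull event is the law of the curve on the corresponding closed
curve event**: `law(K_δ) {K ⊆ F} = law(γ_δ) {range ⊆ F}`. [folklore] -/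
theorem map_range_setOf_subset_eq (P : Measure (HexDomainSAW Ω δ u v)) {F : Set ℂ}
    (hF : IsClosed F) :
    (P.map fun γ : HexDomainSAW Ω δ u v =>
        (⟨⟨γ.curve.range, γ.curve.isCompact_range⟩, γ.curve.range_nonempty⟩ : NonemptyCompacts ℂ))
      {K : NonemptyCompacts ℂ | (K : Set ℂ) ⊆ F} =
    (P.map fun γ : HexDomainSAW Ω δ u v => γ.curve) (CurveClass.rangeSubset F) := by
  rw [Measure.map_apply measurable_rangeOfSAW (isClosed_setOf_coe_subset hF).measurableSet,
    Measure.map_apply (EmbDomainSAW.measurable_of_top _) (CurveClass.measurableSet_rangeSubset hF)]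
  rfl

/-- **Avoiding a closed set forces the hull event**: for `u ≠ v` (so that every range lies in
`closure Ω`) and closed `S`, `F` with `closure Ω ∖ S ⊆ F`:
`law(K_δ) {K ∩ S = ∅} ≤ law(K_δ) {K ⊆ F}`. [folklore] -/
theorem map_range_setOf_disjoint_le (P : Measure (HexDomainSAW Ω δ u v)) (huv : u ≠ v)
    {S F : Set ℂ} (hS : IsClosed S) (hF : IsClosed F) (hSF : closure Ω \ S ⊆ F) :
    (P.map fun γ : HexDomainSAW Ω δ u v =>
        (⟨⟨γ.curve.range, γ.curve.isCompact_range⟩, γ.curve.range_nonempty⟩ : NonemptyCompacts ℂ))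
      {K : NonemptyCompacts ℂ | Disjoint (K : Set ℂ) S} ≤
    (P.map fun γ : HexDomainSAW Ω δ u v =>
        (⟨⟨γ.curve.range, γ.curve.isCompact_range⟩, γ.curve.range_nonempty⟩ : NonemptyCompacts ℂ))
      {K : NonemptyCompacts ℂ | (K : Set ℂ) ⊆ F} := by
  rw [Measure.map_apply measurable_rangeOfSAW
      (Literature.MeasureTheory.RandomSets.isOpen_setOf_disjoint_of_isClosed hS).measurableSet,
    Measure.map_apply measurable_rangeOfSAW (isClosed_setOf_coe_subset hF).measurableSet]
  refine measure_mono fun γ (hγ : Disjoint γ.curve.range S) => ?_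
  change γ.curve.range ⊆ F
  exact fun x hx => hSF ⟨range_curve_subset_closure huv γ hx, Set.disjoint_left.1 hγ hx⟩

/-- **All ranges lie in `closure Ω`** (`u ≠ v`): the law of the range gives no mass outside the
compact piece `{K | K ⊆ closure Ω}` of the hyperspace. [folklore] -/
theorem map_range_compl_setOf_subset_closure (P : Measure (HexDomainSAW Ω δ u v)) (huv : u ≠ v) :
    (P.map fun γ : HexDomainSAW Ω δ u v =>
        (⟨⟨γ.curve.range, γ.curve.isCompact_range⟩, γ.curve.range_nonempty⟩ : NonemptyCompacts ℂ))
      {K : NonemptyCompacts ℂ | (K : Set ℂ) ⊆ closure Ω}ᶜ = 0 := by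
  rw [Measure.map_apply measurable_rangeOfSAW
    (isClosed_setOf_coe_subset isClosed_closure).measurableSet.compl]
  convert measure_empty (μ := P)
  refine Set.eq_empty_of_forall_notMem fun γ hγ => hγ ?_
  exact range_curve_subset_closure huv γ

omit [BorelSpace (NonemptyCompacts ℂ)] in
/-- A sure event of the ranges has full image measure. [folklore] -/
theorem map_range_eq_of_forall (P : Measure (HexDomainSAW Ω δ u v)) [IsProbabilityMeasure P]
    {E : Set (NonemptyCompacts ℂ)} (hE : MeasurableSet E)
    (h : ∀ γ : HexDomainSAW Ω δ u v,
      (⟨⟨γ.curve.range, γ.curve.isCompact_range⟩, γ.curve.range_nonempty⟩ : NonemptyCompacts ℂ) ∈ E) :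
    (P.map fun γ : HexDomainSAW Ω δ u v =>
        (⟨⟨γ.curve.range, γ.curve.isCompact_range⟩, γ.curve.range_nonempty⟩ : NonemptyCompacts ℂ))
      E = 1 := by
  rw [Measure.map_apply measurable_rangeOfSAW hE]
  convert measure_univ (μ := P)
  exact Set.eq_univ_of_forall h

end Laws

/-! ### Extraction of subsequential limits and what they inherit -/

section Limit

variable [MeasurableSpace (NonemptyCompacts ℂ)] [BorelSpace (NonemptyCompacts ℂ)]
  {D : DobrushinDomain} {a b : ℝ → HexVertex}

/-- **Subsequential limits of the range laws exist and inherit the avoidance cocycle** (module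
docstring): for every sequence of meshes `s n → 0⁺` there are `N₀`, a subsequence `φ` and a
probability measure `ν` on `NonemptyCompacts ℂ`, the weak limit of the laws of the ranges along
`s (φ n + N₀)`, such that (H1) `μ {range ⊆ cl D'} ≤ ν {K ⊆ cl D'}` for every hull subdomain
`D'` at which the closed-event probabilities converge to the `μ`-value, (H2)
`ν {K ∩ S = ∅} ≤ μ {range ⊆ cl D'}` for closed `S` with `cl D ∖ S ⊆ cl D'`, and (H3) `ν`-a.s.
`K ⊆ cl D` is connected and contains both marked points.  Prokhorov on the compact piece
`{K ⊆ cl D}` of the hyperspace (no tightness estimate) and the portmanteau theorem.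
[cite: Billingsley1999, Thm 2.1 and Thm 5.1] -/
theorem exists_subseqLimit (hab : IsEmbEndpointApprox hexGraph hexCenter D a b)
    (μ : Measure (CurveClass ℂ))
    (hC : ∀ D' : DobrushinDomain, D.IsHullSubdomain D' →
      Tendsto (fun δ : ℝ => ((hexSAWLaw D.carrier δ (a δ) (b δ)).map
        (fun γ : HexDomainSAW D.carrier δ (a δ) (b δ) => γ.curve))
        (CurveClass.rangeSubset (closure D'.carrier)))
        (𝓝[>] 0) (𝓝 (μ (CurveClass.rangeSubset (closure D'.carrier)))))
    {s : ℕ → ℝ} (hs : Tendsto s atTop (𝓝[>] 0)) :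
    ∃ (N₀ : ℕ) (φ : ℕ → ℕ) (ν : ProbabilityMeasure (NonemptyCompacts ℂ)), StrictMono φ ∧
      (∀ f : NonemptyCompacts ℂ →ᵇ ℝ, Tendsto (fun n => ∫ γ,
          f (⟨⟨γ.curve.range, γ.curve.isCompact_range⟩, γ.curve.range_nonempty⟩ : NonemptyCompacts ℂ)
          ∂(hexSAWLaw D.carrier (s (φ n + N₀)) (a (s (φ n + N₀))) (b (s (φ n + N₀)))))
        atTop (𝓝 (∫ K, f K ∂(ν : Measure (NonemptyCompacts ℂ))))) ∧
      (∀ D' : DobrushinDomain, D.IsHullSubdomain D' →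
        μ (CurveClass.rangeSubset (closure D'.carrier)) ≤
          (ν : Measure (NonemptyCompacts ℂ)) {K | (K : Set ℂ) ⊆ closure D'.carrier}) ∧
      (∀ (D' : DobrushinDomain) (S : Set ℂ), D.IsHullSubdomain D' → IsClosed S →
        closure D.carrier \ S ⊆ closure D'.carrier →
        (ν : Measure (NonemptyCompacts ℂ)) {K | Disjoint (K : Set ℂ) S} ≤
          μ (CurveClass.rangeSubset (closure D'.carrier))) ∧
      (∀ᵐ (K : NonemptyCompacts ℂ) ∂(ν : Measure (NonemptyCompacts ℂ)),
        (K : Set ℂ) ⊆ closure D.carrier ∧ IsPreconnected (K : Set ℂ) ∧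
          D.pt 0 ∈ (K : Set ℂ) ∧ D.pt 1 ∈ (K : Set ℂ)) := by
  -- notation
  set P : ∀ δ : ℝ, Measure (HexDomainSAW D.carrier δ (a δ) (b δ)) :=
    fun δ => hexSAWLaw D.carrier δ (a δ) (b δ) with hPdef
  set Kf : ∀ δ : ℝ, HexDomainSAW D.carrier δ (a δ) (b δ) → NonemptyCompacts ℂ :=
    fun δ γ => ⟨⟨γ.curve.range, γ.curve.isCompact_range⟩, γ.curve.range_nonempty⟩ with hKfdef
  -- the eventual lattice facts, pulled back along `s`
  have hev : ∀ᶠ n in atTop, IsProbabilityMeasure (P (s n)) ∧ a (s n) ≠ b (s n) :=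
    hs.eventually ((eventually_isProbabilityMeasure_hexSAWLaw hab).and
      (eventually_ne_of_tendsto hab.tendsto_fst hab.tendsto_snd))
  obtain ⟨N₀, hN₀⟩ := eventually_atTop.1 hev
  have hprob : ∀ n, IsProbabilityMeasure (P (s (n + N₀))) := fun n => (hN₀ _ (Nat.le_add_left _ _)).1
  have hne : ∀ n, a (s (n + N₀)) ≠ b (s (n + N₀)) := fun n => (hN₀ _ (Nat.le_add_left _ _)).2
  -- the laws of the ranges along the shifted sequence, as probability measures
  set law : ℕ → ProbabilityMeasure (NonemptyCompacts ℂ) := fun n =>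
    ⟨(P (s (n + N₀))).map (Kf (s (n + N₀))),
      @Measure.isProbabilityMeasure_map _ _ _ _ (P (s (n + N₀))) (hprob n) _
        measurable_rangeOfSAW.aemeasurable⟩ with hlawdef
  have hlaw : ∀ n, (law n : Measure (NonemptyCompacts ℂ)) = (P (s (n + N₀))).map (Kf (s (n + N₀))) :=
    fun n => rfl
  -- all carried by the compact piece `{K ⊆ closure D}`
  have hcpt : IsCompact {K : NonemptyCompacts ℂ | (K : Set ℂ) ⊆ closure D.carrier} :=
    isCompact_setOf_coe_subset (D.isBounded.isCompact_closure)
  obtain ⟨ν, φ, hφ, hconv⟩ := exists_tendsto_subseq_of_measure_compl_eq_zero hcpt law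
    fun n => by rw [hlaw]; exact map_range_compl_setOf_subset_closure _ (hne n)
  -- the shifted subsequence of meshes still tends to `0⁺`
  have hs' : Tendsto (fun n => s (φ n + N₀)) atTop (𝓝[>] 0) :=
    hs.comp ((tendsto_add_atTop_nat N₀).comp hφ.tendsto_atTop)
  refine ⟨N₀, φ, ν, hφ, fun f => ?_, fun D' hD' => ?_, fun D' S hD' hS hDS => ?_, ?_⟩
  · -- weak convergence, integral form
    have h1 := (ProbabilityMeasure.tendsto_iff_forall_integral_tendsto.1 hconv) f
    refine h1.congr fun n => ?_
    change ∫ K, f K ∂((law (φ n) : Measure (NonemptyCompacts ℂ))) = _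
    rw [hlaw, integral_map measurable_rangeOfSAW.aemeasurable f.continuous.aestronglyMeasurable]
  · -- (H1): the closed hull event
    have hF : IsClosed {K : NonemptyCompacts ℂ | (K : Set ℂ) ⊆ closure D'.carrier} :=
      isClosed_setOf_coe_subset isClosed_closure
    refine le_measure_of_tendsto_of_isClosed hconv hF ((hC D' hD').comp hs') ?_
    refine Eventually.of_forall fun n => le_of_eq ?_
    change _ = (law (φ n) : Measure (NonemptyCompacts ℂ)) _
    rw [hlaw, map_range_setOf_subset_eq _ isClosed_closure]
    rfl
  · -- (H2): the open avoidance event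
    refine measure_le_of_tendsto_of_isOpen hconv
      (Literature.MeasureTheory.RandomSets.isOpen_setOf_disjoint_of_isClosed hS)
      ((hC D' hD').comp hs') ?_
    refine Eventually.of_forall fun n => ?_
    change (law (φ n) : Measure (NonemptyCompacts ℂ)) _ ≤ _
    rw [hlaw, Function.comp_apply, ← map_range_setOf_subset_eq _ isClosed_closure]
    exact map_range_setOf_disjoint_le _ (hne (φ n)) hS isClosed_closure hDS
  · -- (H3): almost sure properties of the limit
    have h3a : ∀ᵐ (K : NonemptyCompacts ℂ) ∂(ν : Measure (NonemptyCompacts ℂ)),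
        (K : Set ℂ) ⊆ closure D.carrier := by
      refine ae_mem_of_tendsto_of_isClosed hconv (isClosed_setOf_coe_subset isClosed_closure) ?_
      refine Eventually.of_forall fun n => ?_
      change (law (φ n) : Measure (NonemptyCompacts ℂ)) _ = 1
      haveI := hprob (φ n)
      rw [hlaw]
      exact map_range_eq_of_forall _ (isClosed_setOf_coe_subset isClosed_closure).measurableSet
        fun γ => range_curve_subset_closure (hne (φ n)) γ
    have h3b : ∀ᵐ (K : NonemptyCompacts ℂ) ∂(ν : Measure (NonemptyCompacts ℂ)),
        IsPreconnected (K : Set ℂ) := by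
      refine ae_mem_of_tendsto_of_isClosed hconv isClosed_setOf_isPreconnected ?_
      refine Eventually.of_forall fun n => ?_
      change (law (φ n) : Measure (NonemptyCompacts ℂ)) _ = 1
      haveI := hprob (φ n)
      rw [hlaw]
      exact map_range_eq_of_forall _ isClosed_setOf_isPreconnected.measurableSet
        fun γ => isPreconnected_range_curve γ
    have hpt : ∀ (p : ℝ → ℂ) (p₀ : ℂ), Tendsto p (𝓝[>] 0) (𝓝 p₀) →
        (∀ δ (γ : HexDomainSAW D.carrier δ (a δ) (b δ)), p δ ∈ γ.curve.range) →
        ∀ᵐ (K : NonemptyCompacts ℂ) ∂(ν : Measure (NonemptyCompacts ℂ)), p₀ ∈ (K : Set ℂ) := by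
      intro p p₀ hp hmem
      refine ae_mem_coe_of_tendsto hconv (hp.comp hs') ?_
      refine Eventually.of_forall fun n => ?_
      change (law (φ n) : Measure (NonemptyCompacts ℂ)) _ = 1
      haveI := hprob (φ n)
      rw [hlaw]
      exact map_range_eq_of_forall _ (isClosed_setOf_mem_coe _).measurableSet fun γ => hmem _ γ
    filter_upwards [h3a, h3b,
      hpt _ _ hab.tendsto_fst fun δ γ => start_mem_range_curve γ,
      hpt _ _ hab.tendsto_snd fun δ γ => end_mem_range_curve γ] with K h1 h2 h3 h4
    exact ⟨h1, h2, h3, h4⟩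

end Limit

/-! ### Registered form (part 1b of `stub_rangeIdentification`) -/

/-- **Registered helper `rangeIdentification_subseqLimit`** (crux item stmt-CriticalPhenomena-0808,
line `root-locality-replaces-loewner`, stub `stub_rangeIdentification`, part 1b): the statement of
`exists_subseqLimit` with all binders after the colon — relative compactness of the RANGE laws of
the critical hexagonal SAW along any sequence of meshes (Prokhorov on the compact piece
`{K ⊆ cl D}` of the hyperspace, no tightness input) and the portmanteau inheritance (H1)–(H3) of
the closed-event limits supplied by the avoidance cocycle.
[cite: Billingsley1999, Thm 2.1 and Thm 5.1] -/
theorem rangeIdentification_subseqLimit : ∀ [MeasurableSpace (TopologicalSpace.NonemptyCompacts ℂ)] [BorelSpace (TopologicalSpace.NonemptyCompacts ℂ)] (D : Literature.Probability.RandomPlanarGeometry.DobrushinDomain) (a b : ℝ → Literature.Probability.LatticeModels.HexVertex) (μ : MeasureTheory.Measure (Literature.Probability.RandomPlanarGeometry.CurveClass ℂ)) (s : ℕ → ℝ), Literature.Probability.RandomPlanarGeometry.SAW.IsEmbEndpointApprox Literature.Probability.LatticeModels.hexGraph Literature.Probability.LatticeModels.hexCenter D a b → (∀ D' : Literature.Probability.RandomPlanarGeometry.DobrushinDomain,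 D.IsHullSubdomain D' → Filter.Tendsto (fun δ : ℝ => ((Literature.Probability.RandomPlanarGeometry.SAW.hexSAWLaw D.carrier δ (a δ) (b δ)).map (fun γ : Literature.Probability.RandomPlanarGeometry.SAW.HexDomainSAW D.carrier δ (a δ) (b δ) => γ.curve)) (Literature.Probability.RandomPlanarGeometry.CurveClass.rangeSubset (closure D'.carrier))) (nhdsWithin (0 : ℝ) (Set.Ioi 0)) (nhds (μ (Literature.Probability.RandomPlanarGeometry.CurveClass.rangeSubset (closure D'.carrier))))) → Filter.Tendsto s Filter.atTop (nhdsWithin (0 : ℝ) (Set.Ioi 0)) → ∃ (N₀ : ℕ) (φ : ℕ → ℕ) (ν : MeasureTheory.ProbabilityMeasure (TopologicalSpace.NonemptyCompacts ℂ)), StrictMono φ ∧ (∀ f : BoundedContinuousFunction (TopologicalSpace.NonemptyCompacts ℂ) ℝ, Filter.Tendsto (fun n => ∫ γ, f (⟨⟨γ.curve.range, γ.curve.isCompact_range⟩, γ.curve.range_nonempty⟩ : TopologicalSpace.NonemptyCompacts ℂ) ∂(Literature.Probability.RandomPlanarGeometry.SAW.hexSAWLaw D.carrier (s (φ n + N₀))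 (a (s (φ n + N₀))) (b (s (φ n + N₀))))) Filter.atTop (nhds (∫ K, f K ∂(ν : MeasureTheory.Measure (TopologicalSpace.NonemptyCompacts ℂ))))) ∧ (∀ D' : Literature.Probability.RandomPlanarGeometry.DobrushinDomain, D.IsHullSubdomain D' → μ (Literature.Probability.RandomPlanarGeometry.CurveClass.rangeSubset (closure D'.carrier)) ≤ (ν : MeasureTheory.Measure (TopologicalSpace.NonemptyCompacts ℂ)) {K | (K : Set ℂ) ⊆ closure D'.carrier}) ∧ (∀ (D' : Literature.Probability.RandomPlanarGeometry.DobrushinDomain) (S : Set ℂ), D.IsHullSubdomain D' → IsClosed S → closure D.carrier \ S ⊆ closure D'.carrier → (ν : MeasureTheory.Measure (TopologicalSpace.NonemptyCompacts ℂ)) {K | Disjoint (K : Set ℂ) S} ≤ μ (Literature.Probability.RandomPlanarGeometry.CurveClass.rangeSubset (closure D'.carrier))) ∧ (∀ᵐ (K : TopologicalSpace.NonemptyCompacts ℂ) ∂(ν : MeasureTheory.Measure (TopologicalSpace.NonemptyCompacts ℂ)), (K : Set ℂ) ⊆ closure D.carrier ∧ IsPreconnected (K : Set ℂ) ∧ D.pt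 0 ∈ (K : Set ℂ) ∧ D.pt 1 ∈ (K : Set ℂ)) :=
  fun _ _ _ μ _ hab hC hs => exists_subseqLimit hab μ hC hs

end Summit.CriticalPhenomena.SAWScalingLimit.Theorems.HexConjecture.RootLocality.Range

end
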